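import Mathlib.Analysis.Real.Cardinality
import Literature.ModelTheory.Quasiminimal.SelfEmbeddings
import Literature.ModelTheory.ExponentialFields.DirectLimit
import HarnessLib

/-!
# An exponential field of cardinality continuum from a countable quasiminimal one

Let `M` be a countable exponential field carrying a weakly quasiminimal pregeometry structure
(for some language `L` and closure `cl`) with a basis `b : ℕ ⊕ (ℕ ⊕ ℕ) → M`, such that every
partial embedding of `M` into itself defined on all of `M` is an E-ring endomorphism (this is
the case when `L` names the graphs of `+`, `·` and `exp`). By `SelfEmbeddings.lean` there is a
functorial system `Ψ X Y` of closed self-embeddings of `M` indexed by the finite subsets of `ℝ`;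
by `ExponentialFields/DirectLimit.lean` its direct limit `F` is an exponential field, into which
every chart `M` embeds as an E-subfield, and

* `#F = 𝔠` (`Setup.mk_F`): at most `#(Finset ℝ) · #M = 𝔠`, and at least `𝔠` because the
  separated element `v` has pairwise distinct images `[v]_{{s}}`, `s ∈ ℝ`;
* `F` is algebraically closed / has surjective exponential / has the kernel of `M` as soon as
  `M` does (`Setup.isAlgClosed_F`, `Setup.isSurjectiveOntoUnits_F`, `Setup.mem_expKernel_F_iff`).

This is the cardinal-arithmetic end of the existence of a model of cardinality exactly `2^ℵ₀`
in a quasiminimal class (Kirby 2010, Thm 4.2; Bays–Kirby 2018, Thm 8.2 / Cor. 9.4), for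
exponential fields.

## References

* J. Kirby, *On quasiminimal excellent classes*, J. Symbolic Logic 75 (2010), Thm 4.2.
* M. Bays, J. Kirby, *Pseudo-exponential maps, variants, and quasiminimality*, Algebra & Number
  Theory 12 (2018), Thm 8.2.
-/

noncomputable section

suppress_compilation

open Set FirstOrder FirstOrder.Language Cardinal
open Literature.ModelTheory.ExponentialFields

namespace Literature.ModelTheory.Quasiminimal

variable (L : Language.{0, 0}) (M : Type) [L.Structure M] [Field M] [ExponentialRing M]
  (cl : Set M → Set M)

/-- The data for the continuum model: a countable exponential field with a weakly quasiminimal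
pregeometry structure, a basis indexed by `ℕ ⊕ (ℕ ⊕ ℕ)`, and the compatibility of partial
embeddings with the E-field structure. [folklore] -/
structure Setup : Type where
  /-- a basis of `M`, split in three infinite parts -/
  b : ℕ ⊕ (ℕ ⊕ ℕ) → M
  /-- `M` is countable -/
  countable : Countable M
  /-- `M` is a weakly quasiminimal pregeometry structure -/
  isWQPS : IsWeaklyQuasiminimalPregeometryStructure L M cl
  /-- `b` is independent -/
  indep : IndepFamilyOver cl ∅ b
  /-- `b` spans -/
  span : cl (range b) = Set.univ
  /-- partial embeddings of `M` into itself are E-ring endomorphisms -/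
  hom_of_isQFEmbOn : ∀ σ : M → M, IsQFEmbOn L σ Set.univ → ∃ e : ExponentialRingHom M M, ⇑e = σ
  /-- tuples with the same quantifier-free `L`-type have the same quantifier-free type in the
  language of exponential rings -/
  expRing_of_eqQFType : ∀ {n : ℕ} (x y : Fin n → M), L.EqQFType x y →
    Language.expRing.EqQFType x y

namespace Setup

variable {L M cl} (S : Setup L M cl)

/-- The system of closed self-embeddings (chosen). [folklore] -/
def Ψ : Finset ℝ → Finset ℝ → M → M :=
  haveI := S.countable
  Classical.choose (S.isWQPS.exists_selfEmbeddingSystem S.indep S.span ℝ)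

/-- The defining properties of the chosen system `Ψ`. [folklore] -/
theorem Ψ_spec :
    (∀ X : Finset ℝ, S.Ψ X X = id) ∧
    (∀ X Y Z : Finset ℝ, X ⊆ Y → Y ⊆ Z → S.Ψ Y Z ∘ S.Ψ X Y = S.Ψ X Z) ∧
    (∀ X Y : Finset ℝ, X ⊆ Y → IsQFEmbOn L (S.Ψ X Y) Set.univ) ∧
    (∀ X Y : Finset ℝ, X ⊆ Y → cl (range (S.Ψ X Y)) = range (S.Ψ X Y)) ∧
    ∃ v : M, ∀ s t : ℝ, s < t → S.Ψ {s} {s, t} v ≠ S.Ψ {t} {s, t} v :=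
  haveI := S.countable
  Classical.choose_spec (S.isWQPS.exists_selfEmbeddingSystem S.indep S.span ℝ)

/-- `Ψ X X = id`. [folklore] -/
theorem Ψ_self (X : Finset ℝ) : S.Ψ X X = id := S.Ψ_spec.1 X

/-- Functoriality. [folklore] -/
theorem Ψ_comp {X Y Z : Finset ℝ} (hXY : X ⊆ Y) (hYZ : Y ⊆ Z) :
    S.Ψ Y Z ∘ S.Ψ X Y = S.Ψ X Z := S.Ψ_spec.2.1 X Y Z hXY hYZ

/-- Each `Ψ X Y` is a partial embedding on all of `M`. [folklore] -/
theorem Ψ_isQFEmbOn {X Y : Finset ℝ} (hXY : X ⊆ Y) : IsQFEmbOn L (S.Ψ X Y) Set.univ :=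
  S.Ψ_spec.2.2.1 X Y hXY

/-- Each `Ψ X Y` has closed range. [folklore] -/
theorem cl_range_Ψ {X Y : Finset ℝ} (hXY : X ⊆ Y) : cl (range (S.Ψ X Y)) = range (S.Ψ X Y) :=
  S.Ψ_spec.2.2.2.1 X Y hXY

/-- The system separates a point. [folklore] -/
theorem exists_separated : ∃ v : M, ∀ s t : ℝ, s < t → S.Ψ {s} {s, t} v ≠ S.Ψ {t} {s, t} v :=
  S.Ψ_spec.2.2.2.2

/-- The maps of the system as E-ring endomorphisms (chosen). [folklore] -/
def hom (X Y : Finset ℝ) (h : X ≤ Y) : ExponentialRingHom M M :=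
  Classical.choose (S.hom_of_isQFEmbOn _ (S.Ψ_isQFEmbOn h))

/-- The underlying function of `hom X Y h` is `Ψ X Y`. [folklore] -/
@[simp] theorem coe_hom {X Y : Finset ℝ} (h : X ≤ Y) : ⇑(S.hom X Y h) = S.Ψ X Y :=
  Classical.choose_spec (S.hom_of_isQFEmbOn _ (S.Ψ_isQFEmbOn h))

/-- The system of E-ring endomorphisms is a directed system. [folklore] -/
instance directedSystem : DirectedSystem (fun _ : Finset ℝ => M)
    fun X Y h => ⇑(ExpDirectLimit.ringHoms (G := fun _ => M) S.hom X Y h) where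
  map_self X x := by
    change S.hom X X le_rfl x = x
    rw [coe_hom, Ψ_self]; rfl
  map_map {Z Y X} hXY hYZ x := by
    change S.hom Y Z hYZ (S.hom X Y hXY x) = S.hom X Z _ x
    rw [coe_hom, coe_hom, coe_hom, ← S.Ψ_comp hXY hYZ]; rfl

/-- **The continuum model**: the direct limit of the charts `M` along `Ψ`. [folklore] -/
abbrev F : Type := ExpDirectLimit.Lim (G := fun _ : Finset ℝ => M) S.hom

/-- The chart embeddings. [folklore] -/
abbrev of (X : Finset ℝ) : M →+* S.F := ExpDirectLimit.of (G := fun _ : Finset ℝ => M) S.hom X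

/-- Chart embeddings are injective. [folklore] -/
theorem of_injective (X : Finset ℝ) : Function.Injective (S.of X) :=
  ExpDirectLimit.of_injective' S.hom X

/-- Distinct reals give distinct elements `[v]_{{s}}` of the limit. [folklore] -/
theorem of_singleton_ne {v : M} (hv : ∀ s t : ℝ, s < t → S.Ψ {s} {s, t} v ≠ S.Ψ {t} {s, t} v)
    {s t : ℝ} (hst : s < t) : S.of {s} v ≠ S.of {t} v := by
  have hs : ({s} : Finset ℝ) ≤ {s, t} := by simp
  have ht : ({t} : Finset ℝ) ≤ {s, t} := by simp
  have h1 : S.of {s} v = S.of {s, t} (S.Ψ {s} {s, t} v) := by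
    rw [← S.coe_hom hs]; exact (ExpDirectLimit.of_φ S.hom hs v).symm
  have h2 : S.of {t} v = S.of {s, t} (S.Ψ {t} {s, t} v) := by
    rw [← S.coe_hom ht]; exact (ExpDirectLimit.of_φ S.hom ht v).symm
  rw [h1, h2]
  exact fun h => hv s t hst (S.of_injective _ h)

/-- **The continuum model has cardinality exactly `𝔠`.** [cite: Kirby2010QMEC, Thm 4.2] -/
theorem mk_F : #S.F = 𝔠 := by
  haveI := S.countable
  apply le_antisymm
  · refine (ExpDirectLimit.mk_le_of_const (ι := Finset ℝ) S.hom).trans ?_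
    rw [Cardinal.mk_finset_of_infinite, Cardinal.mk_real]
    calc 𝔠 * #M ≤ 𝔠 * ℵ₀ := mul_le_mul' le_rfl Cardinal.mk_le_aleph0
      _ = 𝔠 := Cardinal.continuum_mul_aleph0
  · obtain ⟨v, hv⟩ := S.exists_separated
    rw [← Cardinal.mk_real]
    refine Cardinal.mk_le_of_injective (f := fun s : ℝ => S.of {s} v) fun s t hst => ?_
    by_contra hne
    rcases lt_or_gt_of_ne hne with hlt | hgt
    · exact S.of_singleton_ne hv hlt hst
    · exact S.of_singleton_ne hv hgt hst.symm

/-- Characteristic zero. [folklore] -/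
theorem charZero_F [CharZero M] : CharZero S.F := ExpDirectLimit.charZero S.hom

/-- Characteristic zero, as an instance on `S.F`. [folklore] -/
instance instCharZeroF [CharZero M] : CharZero S.F := S.charZero_F

/-- Algebraic closedness transfers. [folklore] -/
theorem isAlgClosed_F [IsAlgClosed M] : IsAlgClosed S.F := ExpDirectLimit.isAlgClosed S.hom

/-- Surjectivity of `exp` transfers. [folklore] -/
theorem isSurjectiveOntoUnits_F (h : ExponentialRing.IsSurjectiveOntoUnits M) :
    ExponentialRing.IsSurjectiveOntoUnits S.F :=
  ExpDirectLimit.isSurjectiveOntoUnits S.hom fun _ => h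

/-- `exp` on the charts. [folklore] -/
theorem exp_of (X : Finset ℝ) (x : M) :
    ExponentialRing.exp (S.of X x) = S.of X (ExponentialRing.exp x) :=
  ExpDirectLimit.exp_of S.hom X x

/-- The kernel of the continuum model. [folklore] -/
theorem mem_expKernel_F_iff (z : S.F) :
    z ∈ ExponentialRing.expKernel S.F ↔
      ∃ (X : Finset ℝ) (x : M), x ∈ ExponentialRing.expKernel M ∧ S.of X x = z :=
  ExpDirectLimit.mem_expKernel_iff S.hom z

/-- Elements fixed by every `Ψ X Y` have chart-independent image in `F`. [folklore] -/
theorem of_eq_of_of_fixed {x : M} (hx : ∀ X Y : Finset ℝ, X ⊆ Y → S.Ψ X Y x = x)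
    (X Y : Finset ℝ) : S.of X x = S.of Y x := by
  have hX : X ≤ X ∪ Y := Finset.subset_union_left
  have hY : Y ≤ X ∪ Y := Finset.subset_union_right
  rw [← ExpDirectLimit.of_φ S.hom hX x, ← ExpDirectLimit.of_φ S.hom hY x]
  change S.of (X ∪ Y) (S.hom X (X ∪ Y) hX x) = S.of (X ∪ Y) (S.hom Y (X ∪ Y) hY x)
  rw [coe_hom, coe_hom, hx X _ hX, hx Y _ hY]

/-! ### The base field inside the continuum model -/

section Base

variable {K : Type} [Field K] (ιM : K →+* M)
  (hfix : ∀ σ : M → M, IsQFEmbOn L σ Set.univ → ∀ k, σ (ιM k) = ιM k)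

/-- The base embedding into the continuum model (through the chart `∅`). [folklore] -/
def ιF : K →+* S.F := (S.of ∅).comp ιM

include hfix in
/-- Every chart embeds the base in the same way. [folklore] -/
theorem of_ιM (X : Finset ℝ) (k : K) : S.of X (ιM k) = S.ιF ιM k := by
  change S.of X (ιM k) = S.of ∅ (ιM k)
  exact S.of_eq_of_of_fixed (fun X Y hXY => hfix _ (S.Ψ_isQFEmbOn hXY) k) X ∅

/-- The exponential of the continuum model extends the partial exponential of the base when that
of `M` does. [folklore] -/
theorem exp_ιF {D : Set K} {θ : K → K}
    (h : ∀ x ∈ D, ExponentialRing.exp (ιM x) = ιM (θ x)) :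
    ∀ x ∈ D, ExponentialRing.exp (S.ιF ιM x) = S.ιF ιM (θ x) := by
  intro x hx
  change ExponentialRing.exp (S.of ∅ (ιM x)) = S.of ∅ (ιM (θ x))
  rw [S.exp_of, h x hx]

include hfix in
/-- The kernel of the continuum model is that of `M` (read in any chart): if
`ker exp_M = ℤ · ιM τ` then `ker exp_F = ℤ · ιF τ`. [folklore] -/
theorem expKernel_F_eq {τ : K}
    (hker : ExponentialRing.expKernel M = AddSubgroup.zmultiples (ιM τ)) :
    ExponentialRing.expKernel S.F = AddSubgroup.zmultiples (S.ιF ιM τ) := by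
  ext z
  rw [S.mem_expKernel_F_iff, AddSubgroup.mem_zmultiples_iff]
  constructor
  · rintro ⟨X, x, hx, rfl⟩
    rw [hker, AddSubgroup.mem_zmultiples_iff] at hx
    obtain ⟨m, rfl⟩ := hx
    exact ⟨m, by rw [map_zsmul, S.of_ιM ιM hfix X τ]⟩
  · rintro ⟨m, rfl⟩
    refine ⟨∅, m • ιM τ, ?_, ?_⟩
    · rw [hker]; exact AddSubgroup.zsmul_mem _ (AddSubgroup.mem_zmultiples _) m
    · rw [map_zsmul]; rfl

end Base

end Setup

end Literature.ModelTheory.Quasiminimal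

end
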